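import Literature.NumberTheory.Sieve.SingularSeries
import HarnessLib

/-!
# The singular series: rate of convergence of the ordered partial products

Topic `Literature/NumberTheory/Sieve`; a small complement to `SingularSeries.lean` (Hardy–Littlewood
singular series `𝔖(H) = ∏_p (1 - ν_H(p)/p)(1 - 1/p)^{-k}`, `singularSeriesPartial H x = ∏_{p ≤ x} …`,
`tendsto_singularSeriesPartial_holds`). Since the Euler factors are `1 + O_k(p^{-2})`
(`exists_abs_singularSeriesFactor_sub_one_le`), the partial products converge at the rate `O(1/x)`;
this quantitative form is what the main-term computations of Goldston–Yıldırım type consume (e.g.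
Tao–Teräväinen 2022, §8, where the Euler product is taken over the primes below a large cutoff:
"`∏_p E_{p,t} = 𝔖 log^{-k}x ∏_j (1+t_{0,j}) + O(…)`"). Everything here is PROVED:

* `abs_prod_singularSeriesFactor_sub_one_le` — for `N₀ ≤ N ≤ N'` beyond the threshold,
  `|∏_{N < p ≤ N'} factor(p) − 1| ≤ e^{4k²/N} − 1`;
* **`exists_abs_singularSeries_sub_partial_le`** — `∃ N₀ C, ∀ N ≥ N₀, |𝔖(H) − ∏_{p≤N} factor(p)| ≤ C/N`.
  [cite: HalberstamRichert1974, Ch. 10]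
-/

noncomputable section

open Filter Finset Real
open scoped Topology

namespace Literature.NumberTheory.Sieve

/-- The partial products factor: `∏_{p ≤ N'} = (∏_{p ≤ N'}, p > N}) · ∏_{p ≤ N}`. [folklore] -/
theorem singularSeriesPartial_eq_mul (H : Finset ℤ) {N N' : ℕ} (h : N ≤ N') :
    singularSeriesPartial H N' =
      (∏ p ∈ Nat.primesLE N' \ Nat.primesLE N, singularSeriesFactor H p) * singularSeriesPartial H N := by
  unfold singularSeriesPartial
  rw [Finset.prod_sdiff (Nat.primesLE_mono h)]

/-- **The tail product is close to `1`**: if `|factor(p) − 1| ≤ 4k²/p²` for all primes `p ≥ N₀`, then for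
`N₀ ≤ N ≤ N'` (`N ≥ 1`), `|∏_{N < p ≤ N'} factor(p) − 1| ≤ exp(4k²/N) − 1`. [cite: HalberstamRichert1974, Ch. 10] -/
theorem abs_prod_singularSeriesFactor_sub_one_le (H : Finset ℤ) {N₀ : ℕ}
    (hN₀ : ∀ p : ℕ, N₀ ≤ p → p.Prime → |singularSeriesFactor H p - 1| ≤ 4 * (H.card : ℝ) ^ 2 * ((p : ℝ) ^ 2)⁻¹)
    {N N' : ℕ} (hN : N₀ ≤ N) (hN1 : 1 ≤ N) (hNN' : N ≤ N') :
    |(∏ p ∈ Nat.primesLE N' \ Nat.primesLE N, singularSeriesFactor H p) - 1| ≤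
      Real.exp (4 * (H.card : ℝ) ^ 2 / N) - 1 := by
  set T := Nat.primesLE N' \ Nat.primesLE N with hT
  have hmemT : ∀ p ∈ T, p.Prime ∧ N < p ∧ p ≤ N' := by
    intro p hp
    rw [hT, Finset.mem_sdiff, Nat.mem_primesLE, Nat.mem_primesLE] at hp
    refine ⟨hp.1.2, ?_, hp.1.1⟩
    by_contra h
    exact hp.2 ⟨not_lt.mp h, hp.1.2⟩
  have h1 : |(∏ p ∈ T, singularSeriesFactor H p) - 1| ≤
      Real.exp (∑ p ∈ T, |singularSeriesFactor H p - 1|) - 1 := by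
    have h := Finset.norm_prod_one_add_sub_one_le T (fun p => singularSeriesFactor H p - 1)
    simp only [add_sub_cancel, Real.norm_eq_abs] at h
    exact h
  refine h1.trans (sub_le_sub_right (Real.exp_le_exp.mpr ?_) 1)
  -- `∑_{p ∈ T} |f_p − 1| ≤ 4k² ∑_{N < n ≤ N'} 1/n² ≤ 4k²/N`
  calc ∑ p ∈ T, |singularSeriesFactor H p - 1| ≤ ∑ p ∈ T, 4 * (H.card : ℝ) ^ 2 * ((p : ℝ) ^ 2)⁻¹ :=
        sum_le_sum fun p hp => hN₀ p (hN.trans (hmemT p hp).2.1.le) (hmemT p hp).1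
    _ ≤ ∑ n ∈ Ioc N N', 4 * (H.card : ℝ) ^ 2 * ((n : ℝ) ^ 2)⁻¹ := by
        refine sum_le_sum_of_subset_of_nonneg (fun p hp => ?_) fun n _ _ => by positivity
        rw [mem_Ioc]; exact ⟨(hmemT p hp).2.1, (hmemT p hp).2.2⟩
    _ = 4 * (H.card : ℝ) ^ 2 * ∑ n ∈ Ioc N N', ((n : ℝ) ^ 2)⁻¹ := by rw [mul_sum]
    _ ≤ 4 * (H.card : ℝ) ^ 2 * ((N : ℝ)⁻¹ - (N' : ℝ)⁻¹) :=
        mul_le_mul_of_nonneg_left (sum_Ioc_inv_sq_le_sub (by omega) hNN') (by positivity)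
    _ ≤ 4 * (H.card : ℝ) ^ 2 / N := by
        rw [div_eq_mul_inv]
        refine mul_le_mul_of_nonneg_left ?_ (by positivity)
        have : 0 ≤ (N' : ℝ)⁻¹ := by positivity
        linarith

/-- **Rate of convergence of the singular series**: `∃ N₀ C, ∀ N ≥ N₀, |𝔖(H) − ∏_{p ≤ N} factor(p)| ≤ C/N`.
[cite: HalberstamRichert1974, Ch. 10] -/
theorem exists_abs_singularSeries_sub_partial_le (H : Finset ℤ) :
    ∃ N₀ : ℕ, ∃ C : ℝ, 0 ≤ C ∧ ∀ N : ℕ, N₀ ≤ N →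
      |singularSeries H - singularSeriesPartial H N| ≤ C / N := by
  obtain ⟨N₁, hN₁⟩ := exists_abs_singularSeriesFactor_sub_one_le H
  set N₀ : ℕ := max N₁ 1 with hN₀def
  set k2 : ℝ := 4 * (H.card : ℝ) ^ 2 with hk2
  have hk2_0 : 0 ≤ k2 := by positivity
  -- uniform bound on the partial products beyond `N₀`
  set B : ℝ := |singularSeriesPartial H N₀| * Real.exp k2 with hBdef
  have hB0 : 0 ≤ B := by positivity
  have hpartial_le : ∀ N, N₀ ≤ N → |singularSeriesPartial H N| ≤ B := by
    intro N hN
    rw [singularSeriesPartial_eq_mul H hN, abs_mul, hBdef, mul_comm]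
    refine mul_le_mul_of_nonneg_left ?_ (abs_nonneg _)
    have h := abs_prod_singularSeriesFactor_sub_one_le H (N₀ := N₀) (fun p hp hpp => hN₁ p ((le_max_left _ _).trans hp) hpp)
      le_rfl (le_max_right _ _) hN
    have h2 : Real.exp (4 * (H.card : ℝ) ^ 2 / N₀) ≤ Real.exp k2 := by
      refine Real.exp_le_exp.mpr ?_
      rw [hk2]
      refine div_le_self (by positivity) ?_
      exact_mod_cast (le_max_right N₁ 1)
    calc |∏ p ∈ Nat.primesLE N \ Nat.primesLE N₀, singularSeriesFactor H p|
        = |((∏ p ∈ Nat.primesLE N \ Nat.primesLE N₀, singularSeriesFactor H p) - 1) + 1| := by ring_nf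
      _ ≤ |(∏ p ∈ Nat.primesLE N \ Nat.primesLE N₀, singularSeriesFactor H p) - 1| + 1 := by
          simpa using abs_add_le ((∏ p ∈ Nat.primesLE N \ Nat.primesLE N₀, singularSeriesFactor H p) - 1) 1
      _ ≤ (Real.exp (4 * (H.card : ℝ) ^ 2 / N₀) - 1) + 1 := by linarith
      _ ≤ Real.exp k2 := by linarith
  refine ⟨N₀, B * (k2 * Real.exp k2), by positivity, fun N hN => ?_⟩
  have hN1 : 1 ≤ N := (le_max_right N₁ 1).trans hN
  have hNpos : (0 : ℝ) < N := by exact_mod_cast hN1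
  -- for every `N' ≥ N`: `|partial N' − partial N| ≤ B (exp(k2/N) − 1) ≤ B k2 e^{k2}/N`
  have hstep : ∀ N', N ≤ N' → |singularSeriesPartial H N' - singularSeriesPartial H N| ≤ B * (k2 * Real.exp k2) / N := by
    intro N' hNN'
    rw [singularSeriesPartial_eq_mul H hNN', ← sub_one_mul, abs_mul]
    have h := abs_prod_singularSeriesFactor_sub_one_le H (N₀ := N₀) (fun p hp hpp => hN₁ p ((le_max_left _ _).trans hp) hpp)
      hN hN1 hNN'
    have hkN' : 4 * (H.card : ℝ) ^ 2 / N ≤ k2 := by rw [hk2]; exact div_le_self (by positivity) (by exact_mod_cast hN1)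
    calc |(∏ p ∈ Nat.primesLE N' \ Nat.primesLE N, singularSeriesFactor H p) - 1| * |singularSeriesPartial H N|
        ≤ (Real.exp (4 * (H.card : ℝ) ^ 2 / N) - 1) * B :=
          mul_le_mul h (hpartial_le N hN) (abs_nonneg _) (by
            have := Real.add_one_le_exp (4 * (H.card : ℝ) ^ 2 / N)
            have : 0 ≤ 4 * (H.card : ℝ) ^ 2 / N := by positivity
            linarith)
      _ ≤ ((4 * (H.card : ℝ) ^ 2 / N) * Real.exp (4 * (H.card : ℝ) ^ 2 / N)) * B := by
          refine mul_le_mul_of_nonneg_right ?_ hB0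
          -- `e^a − 1 ≤ a e^a` (from `1 − a ≤ e^{-a}`)
          set a := 4 * (H.card : ℝ) ^ 2 / N
          have h1 := Real.add_one_le_exp (-a)
          rw [Real.exp_neg] at h1
          have hpos := Real.exp_pos a
          have h2 : (-a + 1) * Real.exp a ≤ 1 := by
            calc (-a + 1) * Real.exp a ≤ (Real.exp a)⁻¹ * Real.exp a := mul_le_mul_of_nonneg_right h1 hpos.le
              _ = 1 := inv_mul_cancel₀ hpos.ne'
          nlinarith
      _ ≤ ((4 * (H.card : ℝ) ^ 2 / N) * Real.exp k2) * B := by gcongr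
      _ = B * (k2 * Real.exp k2) / N := by rw [hk2]; ring
  -- pass to the limit `N' → ∞`
  have hlim : Tendsto (fun N' => |singularSeriesPartial H N' - singularSeriesPartial H N|) atTop
      (𝓝 |singularSeries H - singularSeriesPartial H N|) :=
    ((tendsto_singularSeriesPartial_holds H).sub tendsto_const_nhds).abs
  exact le_of_tendsto hlim (Filter.eventually_atTop.mpr ⟨N, hstep⟩)

end Literature.NumberTheory.Sieve
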